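import Mathlib
import Summits.Ventures.HodgeRepro.Tier4.Common.CocompactBridge
import Summits.Ventures.HodgeRepro.Tier4.Line1.TorusCocompact
import Summits.Ventures.HodgeRepro.Tier4.Line4.DistributionNonzero
import Summits.Ventures.HodgeRepro.Tier4.Line4.SeesawGenuineRow

/-!
# Tier4/Line4/SeesawDistribution — the weak W5 with EVERY cocompactness input discharged by name: on a genuine-row
plane definite at some real place, for any continuous unitary character pair `(χ, χ′)` (trivial on the rational
points, N2 on the centre) there is Haar / fundamental-domain data `R` with those characters and a test function `f`
with `R.Jc f ≠ 0`; instance on LINE L4's seesaw plane with the correctly transported torus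

Blind re-derivation cell `pub-hodge-repro`, Tier 4 «prove the step» (README §9–§10), seat t4-L4-p2 (gen 2; LINE L4).
Tree path `lean/Summits/Ventures/HodgeRepro/Tier4/Line4/SeesawDistribution.lean`.  Imports typer-2's
`Common/CocompactBridge` (`exists_rtfData_isHaar_closure`: an `RTFData` with given characters, Haar measures and
fundamental domains of compact closure from the cocompactness of the two tori), L1-p5's `Line1/TorusCocompact`
(`cocompact_rationalOf_torusT`, `cocompact_rationalOf_torusT'` — Fujisaki for the tori of a genuine-row plane definite
at some place, (I1-c′)/(I1-c″)), this line's `DistributionNonzero` (`exists_test_Jc_ne_zero`) and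
`SeesawGenuineRow` (`isGenuineRow_mixedRow_transport`).

WHAT IS PROVED.  `exists_rtfData_test_Jc_ne_zero`: `IsDefinite W → IsGenuineRow W → (χ, χ′ continuous unitary
characters, rational-trivial, N2) → ∃ R : RTFData W, R.chi = χ ∧ R.chi' = χ′ ∧ R.IsHaar ∧ ∃ f, IsTestFn W f ∧ R.Jc f ≠ 0`
— the cocompactness of `G(k)\G(𝔸)` (inside `exists_test_Jc_ne_zero`: L1-p5's `quotient_compact_genuine`) and of the
two tori (L1-p5's `cocompact_rationalOf_torusT(')`, through typer-2's bridge) are now THEOREMS; what stays displayed is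
`IsDefinite W` (definiteness at SOME real place — for the seesaw plane, signature `(1,1)` at `w₀`, this is the face's
signs at another real place of `k`) and the characters.  `isGenuineRow_seesawPlane` and
`exists_rtfData_test_Jc_ne_zero_seesawPlane`: the same on LINE L4's `seesawPlane` in the v0.17 binders (plan-4 g2
S13368: `(mixedRow q (a 0) (a 2)).withTransportedTorus g g'` with `_hiso : g * B_{U′} * gᵀ = lam • B_U`, `lam ≠ 0`),
under the normalisation `q.t = 0`, `¬ IsSquare (−q.n)`, `a 0, a 2 ≠ 0`.

WHAT IT IS NOT: the wall.  The test function is a bump; W4's admissible family needs the weight-3 archimedean type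
(census v0.5 V5.5 / V5.6′).  HC_CM is NOT proved by anyone in this repository.
-/

set_option autoImplicit false

noncomputable section

namespace Summit.Ventures.HodgeRepro.Tier4.Line4

open Matrix Summit.Ventures.HodgeRepro.Tier4.Common Summit.Ventures.HodgeRepro.Tier4.Line1 MeasureTheory NumberField
  Topology

section ByName

variable {k : Type} [Field k] [NumberField k] (W : PlaneData k) [MeasurableSpace (GA W)] [BorelSpace (GA W)]

/-- **The weak W5 with the cocompactness inputs discharged by name.** -/
theorem exists_rtfData_test_Jc_ne_zero (hW : IsDefinite W) (hg : IsGenuineRow W)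
    (chi : torusT W → ℂ) (chi' : torusT' W → ℂ)
    (chi_mul : ∀ s t : torusT W, chi (s * t) = chi s * chi t)
    (chi'_mul : ∀ s t : torusT' W, chi' (s * t) = chi' s * chi' t)
    (chi_rational : ∀ t : torusT W, (t : GA W) ∈ rationalPoints W → chi t = 1)
    (chi'_rational : ∀ t : torusT' W, (t : GA W) ∈ rationalPoints W → chi' t = 1)
    (chi_centre : ∀ (z : GA W) (hz : z ∈ centre W),
      chi ⟨z, centre_le_torusT W hz⟩ = chi' ⟨z, centre_le_torusT' W hz⟩)
    (hc : Continuous chi) (hu : ∀ x, ‖chi x‖ = 1) (hc' : Continuous chi') (hu' : ∀ x, ‖chi' x‖ = 1) :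
    ∃ R : RTFData W, R.chi = chi ∧ R.chi' = chi' ∧ R.IsHaar ∧ ∃ f, IsTestFn W f ∧ R.Jc f ≠ 0 := by
  obtain ⟨R, hRchi, hRchi', hRhaar, -, -, compT, compT'⟩ :=
    exists_rtfData_isHaar_closure (W := W) chi chi' chi_mul chi'_mul chi_rational chi'_rational chi_centre
      (cocompact_rationalOf_torusT W hg hW) (cocompact_rationalOf_torusT' W hg hW)
  haveI : R.μT.IsHaarMeasure := hRhaar.1
  haveI : R.μT'.IsHaarMeasure := hRhaar.2.1
  refine ⟨R, hRchi, hRchi', hRhaar, ?_⟩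
  exact exists_test_Jc_ne_zero W R compT compT' hW hg (hRchi ▸ hc) (hRchi ▸ hu) (hRchi' ▸ hc') (hRchi' ▸ hu')

end ByName

section SeesawPlane

variable {k : Type} [Field k] [NumberField k]

/-- **`IsGenuineRow` on LINE L4's `seesawPlane` in the v0.17 binders** (plan-4 g2 S13368 (ii)/(E)): the plane
`(mixedRow q (a 0) (a 2)).withTransportedTorus g g' hgg' hg'g hgΩ` (= `seesawPlane q a g g' …` by `rfl`) with the
re-typed similitude `_hiso : g * (mixedRow q (a 1) (a 3)).B * gᵀ = lam • (mixedRow q (a 0) (a 2)).B`, `lam ≠ 0`, under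
the normalisation `q.t = 0` and `¬ IsSquare (−q.n)`.  It is `isGenuineRow_mixedRow_transport` with `(g, g′) := (g′, g)`
and `lam⁻¹` (`B_eq_of_similitude`). -/
theorem isGenuineRow_seesawPlane (q : QuadData k) (ht : q.t = 0) (hn : ¬ IsSquare (-q.n)) (a : Fin 4 → k)
    (ha0 : a 0 ≠ 0) (ha2 : a 2 ≠ 0) (g g' : Matrix (Fin 4) (Fin 4) k) (hgg' : g * g' = 1) (hg'g : g' * g = 1)
    (hgΩ : g * (PlaneData.mixedRow q (a 0) (a 2)).Ω = (PlaneData.mixedRow q (a 0) (a 2)).Ω * g) (lam : k)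
    (hlam : lam ≠ 0)
    (hiso : g * (PlaneData.mixedRow q (a 1) (a 3)).B * gᵀ = lam • (PlaneData.mixedRow q (a 0) (a 2)).B) :
    IsGenuineRow ((PlaneData.mixedRow q (a 0) (a 2)).withTransportedTorus g g' hgg' hg'g hgΩ) := by
  have hB := B_eq_of_similitude (PlaneData.mixedRow q (a 1) (a 3)).B (PlaneData.mixedRow q (a 0) (a 2)).B g g'
    hg'g lam hiso
  have hiso' : g' * (PlaneData.mixedRow q (a 0) (a 2)).B * g'ᵀ = lam⁻¹ • (PlaneData.mixedRow q (a 1) (a 3)).B := by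
    rw [hB, smul_smul, inv_mul_cancel₀ hlam, one_smul]
  exact isGenuineRow_mixedRow_transport q ht hn (a 0) (a 2) (a 1) (a 3) ha0 ha2 g' g hg'g hgg' hgΩ lam⁻¹ hiso'

/-- **The weak W5 on `seesawPlane` (v0.17 binders), with every cocompactness input by name**: displayed are the
normalisation of `q`, the non-vanishing of the two lines, the re-typed similitude, `IsDefinite` (definiteness at SOME
real place — the face's signs away from `w₀`) and the character pair. -/
theorem exists_rtfData_test_Jc_ne_zero_seesawPlane (q : QuadData k) (ht : q.t = 0) (hn : ¬ IsSquare (-q.n))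
    (a : Fin 4 → k) (ha0 : a 0 ≠ 0) (ha2 : a 2 ≠ 0) (g g' : Matrix (Fin 4) (Fin 4) k) (hgg' : g * g' = 1)
    (hg'g : g' * g = 1)
    (hgΩ : g * (PlaneData.mixedRow q (a 0) (a 2)).Ω = (PlaneData.mixedRow q (a 0) (a 2)).Ω * g) (lam : k)
    (hlam : lam ≠ 0)
    (hiso : g * (PlaneData.mixedRow q (a 1) (a 3)).B * gᵀ = lam • (PlaneData.mixedRow q (a 0) (a 2)).B)
    [MeasurableSpace (GA ((PlaneData.mixedRow q (a 0) (a 2)).withTransportedTorus g g' hgg' hg'g hgΩ))]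
    [BorelSpace (GA ((PlaneData.mixedRow q (a 0) (a 2)).withTransportedTorus g g' hgg' hg'g hgΩ))]
    (hW : IsDefinite ((PlaneData.mixedRow q (a 0) (a 2)).withTransportedTorus g g' hgg' hg'g hgΩ))
    (chi : torusT ((PlaneData.mixedRow q (a 0) (a 2)).withTransportedTorus g g' hgg' hg'g hgΩ) → ℂ)
    (chi' : torusT' ((PlaneData.mixedRow q (a 0) (a 2)).withTransportedTorus g g' hgg' hg'g hgΩ) → ℂ)
    (chi_mul : ∀ s t, chi (s * t) = chi s * chi t) (chi'_mul : ∀ s t, chi' (s * t) = chi' s * chi' t)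
    (chi_rational : ∀ t : torusT ((PlaneData.mixedRow q (a 0) (a 2)).withTransportedTorus g g' hgg' hg'g hgΩ),
      (t : GA ((PlaneData.mixedRow q (a 0) (a 2)).withTransportedTorus g g' hgg' hg'g hgΩ)) ∈
        rationalPoints ((PlaneData.mixedRow q (a 0) (a 2)).withTransportedTorus g g' hgg' hg'g hgΩ) → chi t = 1)
    (chi'_rational : ∀ t : torusT' ((PlaneData.mixedRow q (a 0) (a 2)).withTransportedTorus g g' hgg' hg'g hgΩ),
      (t : GA ((PlaneData.mixedRow q (a 0) (a 2)).withTransportedTorus g g' hgg' hg'g hgΩ)) ∈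
        rationalPoints ((PlaneData.mixedRow q (a 0) (a 2)).withTransportedTorus g g' hgg' hg'g hgΩ) → chi' t = 1)
    (chi_centre : ∀ (z : GA ((PlaneData.mixedRow q (a 0) (a 2)).withTransportedTorus g g' hgg' hg'g hgΩ))
      (hz : z ∈ centre ((PlaneData.mixedRow q (a 0) (a 2)).withTransportedTorus g g' hgg' hg'g hgΩ)),
      chi ⟨z, centre_le_torusT _ hz⟩ = chi' ⟨z, centre_le_torusT' _ hz⟩)
    (hc : Continuous chi) (hu : ∀ x, ‖chi x‖ = 1) (hc' : Continuous chi') (hu' : ∀ x, ‖chi' x‖ = 1) :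
    ∃ R : RTFData ((PlaneData.mixedRow q (a 0) (a 2)).withTransportedTorus g g' hgg' hg'g hgΩ),
      R.chi = chi ∧ R.chi' = chi' ∧ R.IsHaar ∧
        ∃ f, IsTestFn ((PlaneData.mixedRow q (a 0) (a 2)).withTransportedTorus g g' hgg' hg'g hgΩ) f ∧ R.Jc f ≠ 0 :=
  exists_rtfData_test_Jc_ne_zero _ hW (isGenuineRow_seesawPlane q ht hn a ha0 ha2 g g' hgg' hg'g hgΩ lam hlam hiso)
    chi chi' chi_mul chi'_mul chi_rational chi'_rational chi_centre hc hu hc' hu'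

end SeesawPlane

end Summit.Ventures.HodgeRepro.Tier4.Line4

end
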